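import Literature.MathematicalPhysics.KineticTheory.FluctuationUnitaryGroup
import Literature.MathematicalPhysics.KineticTheory.ZeroWavenumberSpace
import Literature.Analysis.UnboundedOperators.SemigroupLaplaceResolventGenerator
import HarnessLib

/-!
# Positivity of the Abel functional of a strongly continuous fluctuation dynamics

Topic `Literature/MathematicalPhysics/KineticTheory` (companion of `FluctuationSpace`,
`FluctuationSpaceStone`, `FluctuationUnitaryGroup`, `ZeroWavenumberSpace`). The ABEL FUNCTIONAL of an
autocorrelation `C(t) = ⟪ψ, U_t ψ⟫` of a strongly continuous one-parameter unitary (or orthogonal)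
group is `A(ν) = ∫₀^∞ e^{-νt} C(t) dt`, `ν > 0` — for the current class `ψ = [J]` of Doyon's
zero-wavenumber space `ℋ₀(μ)` of the infinite chain this is the Abel-regularised Green–Kubo integral
`∫₀^∞ e^{-νt} C_μ(t) dt` of `InfiniteChainDynamics.currentCorrelation`
(`ZeroWavenumberData.inner_currentClass_koopman_eq_currentCorrelation`). We prove the resolvent
identity and its positivity consequence:

* §1 (complex Hilbert space `H`, `U : OneParameterUnitaryGroup H`, `ν > 0`):
  `∫₀^∞ e^{-νt} Re⟪ψ, U(t)ψ⟫ dt = Re⟪ψ, R(ν)ψ⟫ = ν ‖R(ν)ψ‖²`, where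
  `R(ν)ψ = ∫₀^∞ e^{-νt} U(t)ψ dt` is the Laplace transform of the orbit (the tree's
  `C0Semigroup.laplaceResolventFun`, Engel–Nagel II.1.10: `R(ν)ψ ∈ D(A)`, `A R(ν)ψ = νR(ν)ψ - ψ`),
  using the skew-symmetry `Re⟪Aφ, φ⟫ = 0` of the generator of a unitary group
  (`UnitaryRep.inner_generator_eq_neg`); hence `A(ν) > 0` for every `ψ ≠ 0`
  (`R(ν)` is injective). Declared as dot-notation extensions of `UnitaryRep`
  (`Literature/Analysis/UnboundedOperators/UnitaryRep.lean`) with absolute names.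
* §2 (real fluctuation space of a `FluctuationDynamics D` with `D.IsStronglyContinuous`): the same for
  the orthogonal Koopman group, `0 < ∫₀^∞ e^{-νt} ⟪ψ, U_t ψ⟫_ℝ dt` for `ψ ≠ 0`, via the
  complexification `D.unitaryGroup` of `FluctuationUnitaryGroup`; integrability of the integrand.
* §3 (the chain, `Z : ZeroWavenumberData P D`): with zero mean current,
  `C(0) = D.currentCorrelation μ 0 = ‖[J]‖²`, so `[J] ≠ 0 ↔ C(0) ≠ 0 ↔ 0 < C(0)`, and under strong
  continuity of the Koopman group on `ℋ₀` (equivalently: continuity at `t = 0` of the diagonal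
  space-integrated correlations, `FluctuationDynamics.isStronglyContinuous_iff_continuousAt_form`)
  **the Abel functional `∫₀^∞ e^{-νt} C_μ(t) dt` is strictly positive for every `ν > 0` as soon as
  `C_μ(0) > 0`** (`ZeroWavenumberData.abelFunctional_pos_of_currentCorrelation_zero_pos`). This is the
  mechanism that excludes the Bochner junk value `0` of the Abel integral for a genuinely conducting
  state; it is the `ν‖(ν - L)⁻¹[J]‖²` form of the spectral representation
  `A(ν) = ∫ ν/(ν² + ω²) dσ_J(ω)` (Bochner), which is not needed.

What is NOT here: no dynamics is shown to be strongly continuous and no `ZeroWavenumberData` is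
constructed (both are clustering properties of the state, Doyon 2022 Def. 4.8 / Thm 4.11 (III)).
Everything is proved; tagged `[folklore]` (standard semigroup calculus, Engel–Nagel 2000 Ch. II
Thm. 1.10; Reed–Simon I Thm. VIII.7).
-/

noncomputable section

open MeasureTheory Filter Set Function
open scoped InnerProductSpace Topology NNReal

/-! ## §1. Unitary groups on a complex Hilbert space: `∫₀^∞ e^{-νt} Re⟪ψ, U(t)ψ⟫ dt = ν‖R(ν)ψ‖²` -/

namespace Literature.MathematicalPhysics.KineticTheory

section UnitaryGroup

open Literature.Analysis.UnboundedOperators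

variable {H : Type*} [NormedAddCommGroup H] [InnerProductSpace ℂ H] [CompleteSpace H]

/-- The forward semigroup of a unitary group is a contraction semigroup in the growth-bound format
`‖T(t)‖ ≤ 1 · e^{0·t}` of the Laplace-transform lemmas. [folklore] -/
theorem _root_.Literature.Analysis.UnboundedOperators.UnitaryRep.norm_toC0Semigroup_app_le
    (U : OneParameterUnitaryGroup H) (t : ℝ≥0) :
    ‖(OneParameterGroup.toC0Semigroup U.toStrongContRepresentation).app t‖ ≤
      1 * Real.exp (0 * (t : ℝ)) := by
  rw [zero_mul, Real.exp_zero, mul_one, OneParameterGroup.toC0Semigroup_app,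
    UnitaryRep.app_toStrongContRepresentation]
  exact ContinuousLinearMap.opNorm_le_bound _ zero_le_one fun x => by
    rw [UnitaryRep.norm_appReal, one_mul]

/-- The Laplace integrand of the forward semigroup is `e^{-νt} U(t)ψ` on `(0, ∞)`. [folklore] -/
theorem _root_.Literature.Analysis.UnboundedOperators.UnitaryRep.toC0Semigroup_integrand_eq
    (U : OneParameterUnitaryGroup H) (l : ℂ) (ψ : H) {t : ℝ} (ht : 0 < t) :
    Complex.exp (-(l * t)) •
        (OneParameterGroup.toC0Semigroup U.toStrongContRepresentation).app (Real.toNNReal t) ψ =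
      Complex.exp (-(l * t)) • U.appReal t ψ := by
  rw [OneParameterGroup.toC0Semigroup_app, Real.coe_toNNReal t ht.le, UnitaryRep.app_toStrongContRepresentation]

/-- **The Laplace transform of the orbit**, `R(ν)ψ = ∫₀^∞ e^{-νt} U(t)ψ dt`, is the tree's
`laplaceResolventFun` of the forward semigroup. [folklore] -/
theorem _root_.Literature.Analysis.UnboundedOperators.UnitaryRep.laplaceResolventFun_toC0Semigroup_eq
    (U : OneParameterUnitaryGroup H) (l : ℂ) (ψ : H) :
    (OneParameterGroup.toC0Semigroup U.toStrongContRepresentation).laplaceResolventFun l ψ =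
      ∫ t in Ioi (0 : ℝ), Complex.exp (-(l * t)) • U.appReal t ψ := by
  rw [C0Semigroup.laplaceResolventFun]
  exact setIntegral_congr_fun measurableSet_Ioi fun t ht => U.toC0Semigroup_integrand_eq l ψ ht

/-- The integrand `t ↦ e^{-νt} U(t)ψ` is integrable on `(0, ∞)` for `Re ν > 0`. [folklore] -/
theorem _root_.Literature.Analysis.UnboundedOperators.UnitaryRep.integrableOn_exp_smul_appReal
    (U : OneParameterUnitaryGroup H) {l : ℂ} (hl : 0 < l.re) (ψ : H) :
    IntegrableOn (fun t : ℝ => Complex.exp (-(l * t)) • U.appReal t ψ) (Ioi 0) := by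
  have h := C0Semigroup.integrableOn_integrand _ U.norm_toC0Semigroup_app_le hl ψ
  exact h.congr_fun (fun t ht => U.toC0Semigroup_integrand_eq l ψ ht) measurableSet_Ioi

/-- **Skew-symmetry on the diagonal**: `Re⟪Aφ, φ⟫ = 0` for `φ` in the domain of the generator `A`
of a unitary group (`⟪Aφ, φ⟫ = -⟪φ, Aφ⟫ = -conj ⟪Aφ, φ⟫`; Reed–Simon I Thm. VIII.7). [folklore] -/
theorem _root_.Literature.Analysis.UnboundedOperators.UnitaryRep.re_inner_generator_self
    (U : OneParameterUnitaryGroup H)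
    (φ : (OneParameterGroup.generator U.toStrongContRepresentation).domain) :
    (⟪(OneParameterGroup.generator U.toStrongContRepresentation φ : H), (φ : H)⟫_ℂ).re = 0 := by
  have h := U.inner_generator_eq_neg φ φ
  rw [← inner_conj_symm (φ : H) (OneParameterGroup.generator U.toStrongContRepresentation φ : H)]
    at h
  have hre := congrArg Complex.re h
  rw [Complex.neg_re, Complex.conj_re] at hre
  linarith

/-- **The resolvent identity for the Abel functional**: for a strongly continuous one-parameter
unitary group `U`, `ν > 0` and any `ψ`,
`∫₀^∞ e^{-νt} Re⟪ψ, U(t)ψ⟫ dt = ν ‖∫₀^∞ e^{-νt} U(t)ψ dt‖²`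
(`R(ν)ψ ∈ D(A)` with `A R(ν)ψ = νR(ν)ψ - ψ`, Engel–Nagel II Thm. 1.10, so
`⟪ψ, R(ν)ψ⟫ = ν‖R(ν)ψ‖² - ⟪A R(ν)ψ, R(ν)ψ⟫` and the last term is purely imaginary). [folklore] -/
theorem _root_.Literature.Analysis.UnboundedOperators.UnitaryRep.integral_exp_neg_mul_re_inner_appReal
    (U : OneParameterUnitaryGroup H) {ν : ℝ} (hν : 0 < ν) (ψ : H) :
    ∫ t in Ioi (0 : ℝ), Real.exp (-(ν * t)) * (⟪ψ, U.appReal t ψ⟫_ℂ).re =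
      ν * ‖∫ t in Ioi (0 : ℝ), Complex.exp (-((ν : ℂ) * t)) • U.appReal t ψ‖ ^ 2 := by
  set T := OneParameterGroup.toC0Semigroup U.toStrongContRepresentation with hT
  have hM := U.norm_toC0Semigroup_app_le
  have hl : (0 : ℝ) < ((ν : ℂ)).re := by simpa using hν
  set R : H := T.laplaceResolventFun (ν : ℂ) ψ with hR
  have hReq : R = ∫ t in Ioi (0 : ℝ), Complex.exp (-((ν : ℂ) * t)) • U.appReal t ψ :=
    U.laplaceResolventFun_toC0Semigroup_eq (ν : ℂ) ψ
  -- Step 1: the Abel integral is `Re ⟪ψ, R⟫`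
  have hint : IntegrableOn (fun t : ℝ => Complex.exp (-((ν : ℂ) * t)) • U.appReal t ψ) (Ioi 0) :=
    U.integrableOn_exp_smul_appReal hl ψ
  have h1 : ∫ t in Ioi (0 : ℝ), Real.exp (-(ν * t)) * (⟪ψ, U.appReal t ψ⟫_ℂ).re =
      (⟪ψ, R⟫_ℂ).re := by
    have h2 : ∀ t : ℝ, Real.exp (-(ν * t)) * (⟪ψ, U.appReal t ψ⟫_ℂ).re =
        RCLike.re (⟪ψ, Complex.exp (-((ν : ℂ) * t)) • U.appReal t ψ⟫_ℂ) := by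
      intro t
      rw [inner_smul_right, RCLike.re_to_complex, Complex.mul_re]
      have e : Complex.exp (-((ν : ℂ) * t)) = ((Real.exp (-(ν * t)) : ℝ) : ℂ) := by
        rw [Complex.ofReal_exp]; push_cast; ring_nf
      rw [e, Complex.ofReal_re, Complex.ofReal_im, zero_mul, sub_zero]
    simp_rw [h2]
    rw [integral_re (hint.const_inner ψ), integral_inner hint ψ, RCLike.re_to_complex, hReq]
  -- Step 2: `Re ⟪ψ, R⟫ = ν ‖R‖²` from `ψ = νR - AR` and skew-symmetry
  have hRdom : R ∈ (OneParameterGroup.generator U.toStrongContRepresentation).domain :=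
    C0Semigroup.laplaceResolventFun_mem_generator_domain T hM hl ψ
  have hgen : (OneParameterGroup.generator U.toStrongContRepresentation ⟨R, hRdom⟩ : H) =
      (ν : ℂ) • R - ψ :=
    C0Semigroup.generator_laplaceResolventFun T hM hl ψ
  have hψ : ψ = (ν : ℂ) • R - OneParameterGroup.generator U.toStrongContRepresentation ⟨R, hRdom⟩ := by
    rw [hgen]; abel
  have h3 : (⟪ψ, R⟫_ℂ).re = ν * ‖R‖ ^ 2 := by
    have hskew := U.re_inner_generator_self ⟨R, hRdom⟩
    simp only at hskew
    conv_lhs => rw [hψ]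
    rw [inner_sub_left, inner_smul_left, Complex.conj_ofReal, Complex.sub_re, Complex.re_ofReal_mul,
      inner_self_eq_norm_sq_to_K, hskew, sub_zero]
    norm_cast
  rw [h1, h3, hReq]

/-- **Non-negativity of the Abel functional**: `0 ≤ ∫₀^∞ e^{-νt} Re⟪ψ, U(t)ψ⟫ dt` for `ν > 0`.
[folklore] -/
theorem _root_.Literature.Analysis.UnboundedOperators.UnitaryRep.integral_exp_neg_mul_re_inner_appReal_nonneg
    (U : OneParameterUnitaryGroup H) {ν : ℝ} (hν : 0 < ν) (ψ : H) :
    0 ≤ ∫ t in Ioi (0 : ℝ), Real.exp (-(ν * t)) * (⟪ψ, U.appReal t ψ⟫_ℂ).re := by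
  rw [U.integral_exp_neg_mul_re_inner_appReal hν ψ]
  positivity

/-- **Positivity of the Abel functional**: for `ψ ≠ 0` and `ν > 0`,
`0 < ∫₀^∞ e^{-νt} Re⟪ψ, U(t)ψ⟫ dt` (the Laplace transform `R(ν)` is injective:
`R(ν)ψ = 0 ⟹ ψ = νR(ν)ψ - A R(ν)ψ = 0`). [folklore] -/
theorem _root_.Literature.Analysis.UnboundedOperators.UnitaryRep.integral_exp_neg_mul_re_inner_appReal_pos
    (U : OneParameterUnitaryGroup H) {ν : ℝ} (hν : 0 < ν) {ψ : H} (hψ : ψ ≠ 0) :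
    0 < ∫ t in Ioi (0 : ℝ), Real.exp (-(ν * t)) * (⟪ψ, U.appReal t ψ⟫_ℂ).re := by
  set T := OneParameterGroup.toC0Semigroup U.toStrongContRepresentation with hT
  have hM := U.norm_toC0Semigroup_app_le
  have hl : (0 : ℝ) < ((ν : ℂ)).re := by simpa using hν
  have hR0 : T.laplaceResolventFun (ν : ℂ) ψ ≠ 0 := by
    intro h0
    apply hψ
    have hinj := C0Semigroup.injective_laplaceResolvent T hM hl
    refine hinj ?_
    rw [map_zero, C0Semigroup.laplaceResolvent_apply T hM hl, h0]
  rw [U.integral_exp_neg_mul_re_inner_appReal hν ψ, ← U.laplaceResolventFun_toC0Semigroup_eq]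
  have hn : 0 < ‖T.laplaceResolventFun (ν : ℂ) ψ‖ := norm_pos_iff.2 hR0
  positivity

end UnitaryGroup

/-! ## §2. The orthogonal Koopman group of a strongly continuous fluctuation dynamics -/

namespace FluctuationDynamics

open Literature.Analysis.UnboundedOperators

variable {G Ω : Type*} [AddCommGroup G] [MeasurableSpace G] [MeasurableSpace Ω]
  {ν₀ : Measure G} {T : ShiftAction G Ω} (D : FluctuationDynamics ν₀ T)
  [MeasurableNeg G] [ν₀.IsNegInvariant]

/-- The real autocorrelation is the real part of the complexified one:
`⟪ψ, U_t ψ⟫_ℝ = Re⟪ψ + i0, U(t)(ψ + i0)⟫_ℂ`. [folklore] -/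
theorem inner_koopman_eq_re_inner_unitaryGroup (h : D.IsStronglyContinuous) (t : ℝ)
    (ψ : D.FluctuationSpace) :
    ⟪ψ, D.koopman t ψ⟫_ℝ =
      (⟪Complexification.ofReal ψ,
        (D.unitaryGroup h).appReal t (Complexification.ofReal ψ)⟫_ℂ).re := by
  rw [D.unitaryGroup_appReal_ofReal h, Complexification.inner_ofReal_ofReal, Complex.ofReal_re]

variable {D}

/-- **The Abel integrand is integrable**: `t ↦ e^{-νt} ⟪ψ, U_t ψ⟫_ℝ` is integrable on `(0, ∞)` for
`ν > 0` under strong continuity (continuous, bounded by `e^{-νt}‖ψ‖²`). [folklore] -/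
theorem IsStronglyContinuous.integrableOn_exp_neg_mul_inner_koopman (h : D.IsStronglyContinuous)
    {ν : ℝ} (hν : 0 < ν) (ψ : D.FluctuationSpace) :
    IntegrableOn (fun t : ℝ => Real.exp (-(ν * t)) * ⟪ψ, D.koopman t ψ⟫_ℝ) (Ioi 0) := by
  have hcont : Continuous fun t : ℝ => Real.exp (-(ν * t)) * ⟪ψ, D.koopman t ψ⟫_ℝ :=
    (Real.continuous_exp.comp (continuous_const.mul continuous_id).neg).mul
      (continuous_const.inner (h ψ))
  refine Integrable.mono' ((integrableOn_exp_mul_Ioi (neg_neg_of_pos hν) 0).const_mul (‖ψ‖ ^ 2))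
    hcont.aestronglyMeasurable ?_
  refine (ae_restrict_iff' measurableSet_Ioi).2 (Eventually.of_forall fun t _ => ?_)
  rw [norm_mul, Real.norm_of_nonneg (Real.exp_pos _).le, neg_mul, mul_comm (‖ψ‖ ^ 2)]
  refine mul_le_mul_of_nonneg_left ?_ (Real.exp_pos _).le
  calc ‖⟪ψ, D.koopman t ψ⟫_ℝ‖ ≤ ‖ψ‖ * ‖D.koopman t ψ‖ := norm_inner_le_norm _ _
    _ = ‖ψ‖ ^ 2 := by rw [LinearIsometryEquiv.norm_map, sq]

/-- **Non-negativity of the Abel functional of an autocorrelation**: for a strongly continuous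
fluctuation dynamics, `0 ≤ ∫₀^∞ e^{-νt} ⟪ψ, U_t ψ⟫_ℝ dt` (`ν > 0`). [folklore] -/
theorem IsStronglyContinuous.integral_exp_neg_mul_inner_koopman_nonneg (h : D.IsStronglyContinuous)
    {ν : ℝ} (hν : 0 < ν) (ψ : D.FluctuationSpace) :
    0 ≤ ∫ t in Ioi (0 : ℝ), Real.exp (-(ν * t)) * ⟪ψ, D.koopman t ψ⟫_ℝ := by
  simp_rw [D.inner_koopman_eq_re_inner_unitaryGroup h]
  exact (D.unitaryGroup h).integral_exp_neg_mul_re_inner_appReal_nonneg hν _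

/-- **Positivity of the Abel functional of an autocorrelation**: for a strongly continuous
fluctuation dynamics, `ψ ≠ 0` and `ν > 0`, `0 < ∫₀^∞ e^{-νt} ⟪ψ, U_t ψ⟫_ℝ dt`
(= `ν ‖(ν - L)⁻¹ψ‖²` on the complexification). [folklore] -/
theorem IsStronglyContinuous.integral_exp_neg_mul_inner_koopman_pos (h : D.IsStronglyContinuous)
    {ν : ℝ} (hν : 0 < ν) {ψ : D.FluctuationSpace} (hψ : ψ ≠ 0) :
    0 < ∫ t in Ioi (0 : ℝ), Real.exp (-(ν * t)) * ⟪ψ, D.koopman t ψ⟫_ℝ := by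
  simp_rw [D.inner_koopman_eq_re_inner_unitaryGroup h]
  refine (D.unitaryGroup h).integral_exp_neg_mul_re_inner_appReal_pos hν ?_
  intro h0
  apply hψ
  have := congrArg Complexification.re h0
  simpa using this

end FluctuationDynamics

/-! ## §3. The chain: positivity of `∫₀^∞ e^{-νt} C_μ(t) dt` on Doyon's `ℋ₀(μ)` -/

namespace HeatConduction

namespace ZeroWavenumberData

variable {P : OscillatorChain} {D : InfiniteChainDynamics P} (Z : ZeroWavenumberData P D)

/-- **`C(0) = ‖[J]‖²`**: with zero mean current, the equal-time summed covariance
`D.currentCorrelation μ 0 = Σ_x ∫ j_0 j_x dμ` is the squared norm of the current class. [folklore] -/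
theorem currentCorrelation_zero_eq_norm_sq (hmean : ∫ σ, P.bondCurrentZ σ 0 ∂Z.μ = 0) :
    D.currentCorrelation Z.μ 0 = ‖Z.currentClass‖ ^ 2 := by
  have h0 : Z.koopman 0 Z.currentClass = Z.currentClass :=
    Z.toFluctuationDynamics.koopman_zero_apply _
  rw [← Z.inner_currentClass_koopman_eq_currentCorrelation hmean 0, h0, real_inner_self_eq_norm_sq]

/-- `0 ≤ C(0)` (zero mean current). [folklore] -/
theorem currentCorrelation_zero_nonneg (hmean : ∫ σ, P.bondCurrentZ σ 0 ∂Z.μ = 0) :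
    0 ≤ D.currentCorrelation Z.μ 0 := by
  rw [Z.currentCorrelation_zero_eq_norm_sq hmean]
  positivity

/-- **`[J] ≠ 0 ↔ 0 < C(0)`** (zero mean current). [folklore] -/
theorem currentClass_ne_zero_iff (hmean : ∫ σ, P.bondCurrentZ σ 0 ∂Z.μ = 0) :
    Z.currentClass ≠ 0 ↔ 0 < D.currentCorrelation Z.μ 0 := by
  rw [Z.currentCorrelation_zero_eq_norm_sq hmean]
  constructor
  · intro h
    exact pow_pos (norm_pos_iff.2 h) 2
  · intro h h0
    rw [h0, norm_zero] at h
    simp at h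

/-- **The Abel integrand of the chain is integrable** under strong continuity of the Koopman group on
`ℋ₀`: `t ↦ e^{-νt} C_μ(t) ∈ L¹(0, ∞)` for `ν > 0` (zero mean current). [folklore] -/
theorem integrableOn_exp_neg_mul_currentCorrelation
    (hU : Z.toFluctuationDynamics.IsStronglyContinuous)
    (hmean : ∫ σ, P.bondCurrentZ σ 0 ∂Z.μ = 0) {ν : ℝ} (hν : 0 < ν) :
    IntegrableOn (fun t : ℝ => Real.exp (-(ν * t)) * D.currentCorrelation Z.μ t) (Ioi 0) := by
  simp_rw [← Z.inner_currentClass_koopman_eq_currentCorrelation hmean]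
  exact hU.integrableOn_exp_neg_mul_inner_koopman hν Z.currentClass

/-- **Non-negativity of the chain's Abel functional**: `0 ≤ ∫₀^∞ e^{-νt} C_μ(t) dt` for `ν > 0`,
under strong continuity and zero mean current. [folklore] -/
theorem abelFunctional_nonneg (hU : Z.toFluctuationDynamics.IsStronglyContinuous)
    (hmean : ∫ σ, P.bondCurrentZ σ 0 ∂Z.μ = 0) {ν : ℝ} (hν : 0 < ν) :
    0 ≤ ∫ t in Ioi (0 : ℝ), Real.exp (-(ν * t)) * D.currentCorrelation Z.μ t := by
  simp_rw [← Z.inner_currentClass_koopman_eq_currentCorrelation hmean]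
  exact hU.integral_exp_neg_mul_inner_koopman_nonneg hν Z.currentClass

/-- **Positivity of the chain's Abel functional from a non-zero current class**: if the Koopman
group on `ℋ₀(μ)` is strongly continuous, the mean current vanishes and `[J] ≠ 0`, then
`0 < ∫₀^∞ e^{-νt} C_μ(t) dt` for every `ν > 0`. [folklore] -/
theorem abelFunctional_pos (hU : Z.toFluctuationDynamics.IsStronglyContinuous)
    (hmean : ∫ σ, P.bondCurrentZ σ 0 ∂Z.μ = 0) (hJ : Z.currentClass ≠ 0) {ν : ℝ} (hν : 0 < ν) :
    0 < ∫ t in Ioi (0 : ℝ), Real.exp (-(ν * t)) * D.currentCorrelation Z.μ t := by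
  simp_rw [← Z.inner_currentClass_koopman_eq_currentCorrelation hmean]
  exact hU.integral_exp_neg_mul_inner_koopman_pos hν hJ

/-- **Positivity of the chain's Abel functional from `C_μ(0) > 0`**: if the Koopman group on `ℋ₀(μ)`
is strongly continuous, the mean current vanishes and the static value `C_μ(0) = Σ_x ∫ j_0 j_x dμ` is
positive, then `0 < ∫₀^∞ e^{-νt} C_μ(t) dt` for every `ν > 0` — the junk value `0` of the Abel
integral is excluded for a conducting state. [folklore] -/
theorem abelFunctional_pos_of_currentCorrelation_zero_pos
    (hU : Z.toFluctuationDynamics.IsStronglyContinuous)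
    (hmean : ∫ σ, P.bondCurrentZ σ 0 ∂Z.μ = 0) (h0 : 0 < D.currentCorrelation Z.μ 0) {ν : ℝ}
    (hν : 0 < ν) :
    0 < ∫ t in Ioi (0 : ℝ), Real.exp (-(ν * t)) * D.currentCorrelation Z.μ t :=
  Z.abelFunctional_pos hU hmean ((Z.currentClass_ne_zero_iff hmean).2 h0) hν

/-- The momentum-reversal-symmetric form: under `Z.HasMomentumReversal` (so `⟨j_0⟩_μ = 0`
automatically), strong continuity and `C_μ(0) > 0` give a positive Abel functional at every
`ν > 0`. [folklore] -/
theorem abelFunctional_pos_of_hasMomentumReversal (hR : Z.HasMomentumReversal)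
    (hU : Z.toFluctuationDynamics.IsStronglyContinuous) (h0 : 0 < D.currentCorrelation Z.μ 0)
    {ν : ℝ} (hν : 0 < ν) :
    0 < ∫ t in Ioi (0 : ℝ), Real.exp (-(ν * t)) * D.currentCorrelation Z.μ t :=
  Z.abelFunctional_pos_of_currentCorrelation_zero_pos hU (Z.integral_bondCurrent_eq_zero hR) h0 hν

end ZeroWavenumberData

end HeatConduction

end Literature.MathematicalPhysics.KineticTheory

end
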